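import Literature.Geometry.Lorentzian.KerrSchildMultiplierCurrent
import Literature.Geometry.Lorentzian.MinkowskiRadialMultiplier

/-! # Route ClusterCompleteness — crux `AdiabaticMultiKerrILED`: the homothety multiplier current

Helper file for the crux `stmt-FinalStateConjecture-14310` (line `Sketch`, lead c6 wave 1, card
milne-hubble-current): for a coefficient field `G` on `E4 = ℝ⁴` and the Minkowski homothety
(scaling) vector field about an event `x₀`, `S = (x − x₀)^α ∂_α` (components `X^α(y) = y^α − x₀^α`,
so `∂_μ X^β = δ_μ^β`, `div S = 4`), the bulk term of `KerrSchildMultiplierCurrent.lean` is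
`K^S = Q − 2 Q − ½ (S·∂G)(dw, dw) = −Q − ½ ∑_μ (x^μ − x₀^μ) ∑_{αβ} ∂_μ G^{αβ} ∂_αw ∂_βw`
(`Q = ∑_{αβ} G^{αβ} ∂_αw ∂_βw`), and the conformally corrected current `J^S + ¼ L_ϖ` with the
constant Lagrangian weight `ϖ ≡ 4` (`¼ L^μ = w ∑_ν G^{μν} ∂_νw`, `□_G ϖ = 0`) has divergence
`∑_μ ∂_μ (J^S + ¼ L)^μ = (S(w) + w) □_G w − ½ (S·∂G)(dw, dw)`: the `Q`-terms cancel exactly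
(the homothety is conformally Killing for `η` with the right weight), so on a solution of
`□_G w = 0` only the term measuring the failure of `G` to be scale-invariant about `x₀` survives.
[folklore] -/

noncomputable section

-- the doubled `FinalStateConjecture.FinalStateConjecture` path component trips dupNamespace
set_option linter.dupNamespace false

open scoped BigOperators
open Literature.Geometry.Lorentzian

namespace Summit.FinalStateConjecture.FinalStateConjecture.Theorems

/-- `∂_μ (y^β − x₀^β) = δ_μ^β`: the components of the homothety field about `x₀` have the
Kronecker delta as coordinate derivatives. [folklore] -/
theorem homothety_fderiv_component_apply (x₀ x : E4) (β μ : Fin 4) :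
    fderiv ℝ (fun y : E4 ↦ y β - x₀ β) x (E4.basisVector μ) = if β = μ then 1 else 0 := by
  rw [fderiv_sub_const, KerrSchild.fderiv_coord_apply]

/-- The components of the homothety field about `x₀` are differentiable. [folklore] -/
theorem homothety_differentiableAt_component (x₀ x : E4) (α : Fin 4) :
    DifferentiableAt ℝ (fun y : E4 ↦ y α - x₀ α) x :=
  ((KerrSchild.hasFDerivAt_coord α x).sub_const (x₀ α)).differentiableAt

/-- **The wave operator kills constants**: `□_G c = 0` for every coefficient field `G` (the inner
function `y ↦ ∑_ν G^{μν} ∂_ν c` is identically zero). [folklore] -/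
theorem homothety_waveOperator_const (G : E4 → Fin 4 → Fin 4 → ℝ) (c : ℝ) (x : E4) :
    KerrSchild.waveOperator G (fun _ ↦ c) x = 0 := by
  simp [KerrSchild.waveOperator]

/-- **The bulk term of the homothety multiplier.** For the scaling vector field about `x₀`,
`X^α(y) = y^α − x₀^α` (`∂_μ X^β = δ_μ^β`, `∑_μ ∂_μ X^μ = 4`), the bulk term
`K^X = ∑_μ A^μ ∑_β ∂_μX^β p_β − ½ (div X) Q − ½ ∑_μ X^μ (∂_μG)(p, p)` of
`KerrSchild.multiplierBulk` is `Q − 2Q − ½ (X·∂G)(p,p) = −Q − ½ ∑_μ (x^μ − x₀^μ) (∂_μ G)(p, p)`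
with `p = dw(x)`, `Q = ∑_{αβ} G^{αβ} p_α p_β`. [folklore] -/
theorem multiplierBulk_homothety :
    ∀ (G : E4 → Fin 4 → Fin 4 → ℝ) (x₀ : E4) (w : E4 → ℝ) (x : E4),
      KerrSchild.multiplierBulk G (fun y α ↦ y α - x₀ α) w x =
        -(∑ α, ∑ β, G x α β * fderiv ℝ w x (E4.basisVector α) * fderiv ℝ w x (E4.basisVector β)) -
          2⁻¹ * ∑ μ, (x μ - x₀ μ) * ∑ α, ∑ β, fderiv ℝ (fun y ↦ G y α β) x (E4.basisVector μ) *
            fderiv ℝ w x (E4.basisVector α) * fderiv ℝ w x (E4.basisVector β) := by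
  intro G x₀ w x
  simp only [KerrSchild.multiplierBulk, homothety_fderiv_component_apply, ite_mul, one_mul,
    zero_mul, Finset.sum_ite_eq', Finset.mem_univ, if_true]
  -- name the atoms and expand the finite sums
  obtain ⟨p, hp⟩ : ∃ p : Fin 4 → ℝ, ∀ β, fderiv ℝ w x (E4.basisVector β) = p β := ⟨_, fun _ ↦ rfl⟩
  obtain ⟨dG, hdG⟩ : ∃ dG : Fin 4 → Fin 4 → Fin 4 → ℝ, ∀ μ α β,
      fderiv ℝ (fun y ↦ G y α β) x (E4.basisVector μ) = dG μ α β := ⟨_, fun _ _ _ ↦ rfl⟩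
  simp only [hp, hdG]
  simp only [Fin.sum_univ_four, Fin.isValue]
  ring

/-- **The divergence of the conformally corrected homothety current.** For `G` differentiable and
symmetric at `x` and `w` of class `C²` at `x`, the modified current `J^S + ¼ L_ϖ` of the homothety
`S = (x − x₀)^α ∂_α` with the constant Lagrangian weight `ϖ ≡ 4` satisfies
`∑_μ ∂_μ (J^S + ¼ L)^μ (x) = (S(w) + w) □_G w − ½ ∑_μ (x^μ − x₀^μ) ∑_{αβ} ∂_μG^{αβ} ∂_αw ∂_βw`:
by `KerrSchild.sum_fderiv_modifiedCurrent` the divergence is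
`(S(w) + ¼ ϖ w) □_G w + K^S + ¼ ϖ Q − ⅛ (□_G ϖ) w²`, and with `K^S = −Q − ½ (S·∂G)(dw,dw)`
(`multiplierBulk_homothety`), `ϖ = 4` and `□_G 4 = 0` the `Q`-terms cancel. [folklore] -/
theorem sum_fderiv_homothetyCurrent :
    ∀ (G : E4 → Fin 4 → Fin 4 → ℝ) (x₀ : E4) (w : E4 → ℝ) (x : E4)
      (hG : ∀ μ ν, DifferentiableAt ℝ (fun y ↦ G y μ ν) x) (hsymm : ∀ μ ν, G x μ ν = G x ν μ)
      (hw : ContDiffAt ℝ 2 w x),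
      ∑ μ, fderiv ℝ (fun y ↦ KerrSchild.multiplierCurrent G (fun z α ↦ z α - x₀ α) w y μ +
          4⁻¹ * KerrSchild.lagrangianCurrent G (fun _ ↦ (4 : ℝ)) w y μ) x (E4.basisVector μ) =
        ((∑ α, (x α - x₀ α) * fderiv ℝ w x (E4.basisVector α)) + w x) *
            KerrSchild.waveOperator G w x -
          2⁻¹ * ∑ μ, (x μ - x₀ μ) * ∑ α, ∑ β, fderiv ℝ (fun y ↦ G y α β) x (E4.basisVector μ) *
            fderiv ℝ w x (E4.basisVector α) * fderiv ℝ w x (E4.basisVector β) := by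
  intro G x₀ w x hG hsymm hw
  have hX : ∀ α, DifferentiableAt ℝ (fun y : E4 ↦ (fun (z : E4) (α : Fin 4) ↦ z α - x₀ α) y α) x :=
    fun α ↦ homothety_differentiableAt_component x₀ x α
  have hϖ : ContDiffAt ℝ 2 (fun _ : E4 ↦ (4 : ℝ)) x := contDiffAt_const
  rw [KerrSchild.sum_fderiv_modifiedCurrent hG hsymm hX hϖ hw, multiplierBulk_homothety,
    homothety_waveOperator_const]
  ring

end Summit.FinalStateConjecture.FinalStateConjecture.Theorems
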